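import Summits.QuantumFields.YangMills.Theorems.BalabanLadderNTMarkovMirrorChiralFloor
import HarnessLib

/-!
# Crux `NT` (stmt-QuantumFields-19353) / `UVSeamRec.stub_floorsEngine` (stmt-QuantumFields-20043):
# clause (i) of `LowerBounds`, `NT` by name, and the floors-engine two-point half — from the ONE-POINT
# Markov–mirror package (no two-point ceiling)

Seventh file of the Markov–mirror series (fleet lead prover of crux `UVSeamRec`, unit `ym-spine-20043-p1`, g6).
Asymptotic packaging of `Q2_ge_of_boundaryResponse_chiral` (`…MarkovMirrorChiralFloor`): along a unit map `a`
and a family of positive-time femto cubes `Q_β` carrying the lattice support of ONE test function `v` at depth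
`≥ 2`, the engine-grade inputs are ALL ONE-POINT statements about ONE cube per coupling —

* (RBL+SUP) `|kerE_{Q_β}^ζ(Ṽ_v) − p β + 𝒢_β ζ| ≤ √ε/2` for every exterior `ζ` (refined boundary law: the boundary
  response of the smeared density is, to relative leading order, the classical shell functional `𝒢_β`);
* (RBLΔ) `|kerE_{Q_β}^ζ(Wᴿ_v) − kerE_{Q_β}^ζ(Ṽ_v) − p' β| ≤ √ε/2` (the boundary response of the chirality defect —
  a discrete time-derivative of `v` against electric plaquette fields — is small; `O(a β)` under `FBL6` on `Q_β`);
* (SF) `Cov_T(𝒢_β∘Θ₀, 𝒢_β) ≥ 4ε` on every torus `a β·L ≥ Λ₅` (shell floor) —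

and the outputs are: `Q2_floor_of_mirrorPackage_chiral` (`ε ≤ Q2_{β,L,aβ}(θv, v)` for `β ≥ max β₅ 0`,
`a β·L ≥ Λ₅` — NO `a → 0` used: the identity `Q2 = Cov_T(Wᴿ∘Θ₀, Ṽ)` is exact), `lowerBounds_fst_of_mirrorPackage_chiral`
(clause (i) of `LowerBounds G r a`), `floorsTwoPoint_of_mirrorPackage_chiral` (the same with `HasCompactSupport v`
recorded — the two-point conjunct of the registered `UVSeamRec.stub_floorsEngine` at `(SU(2), rF)`, v4-F
f523973980851859, for ANY `(G, r)`), and `nt_of_markovMirror_chiral` (`Theses.BalabanLadder.NT` BY NAME, given in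
addition any supplier of clause (ii)).  Honest status: RBL, RBLΔ's supplier FBL6, and SF are engine-grade (card E,
category c′); nothing here claims them.
-/

set_option autoImplicit false

noncomputable section

open scoped SchwartzMap
open MeasureTheory Filter Topology
open Literature.MathematicalPhysics.QuantumFieldTheory Literature.MathematicalPhysics.QuantumLattice
open Literature.Probability.LatticeModels
open Summit.QuantumFields.YangMills.Cruxes.OSLegsFromFemtoAndGap.DlrCollarTransfer

namespace Summit.QuantumFields.YangMills.Cruxes.NT.MarkovMirror

section Package

variable (G : Type) [Group G] [TopologicalSpace G] [IsTopologicalGroup G] [CompactSpace G]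
  [MeasurableSpace G] [BorelSpace G] (r : LatticeRep G)

/-- **`Q2(θv, v) ≥ ε` for all large couplings and tori, from the one-point Markov–mirror package.**
A unit map `a > 0`, ONE test function `v`, `ε > 0`; for `β ≥ β₅`: a cube `Q_β = (c β, b β)` at times `≥ 1` of physical
size `(|c β j| + b β + 3)·aβ ≤ Λ₅` carrying the lattice support of `v(aβ·)` at depth `≥ 2`; a bounded continuous
cylinder shell functional `𝒢_β` on the closed collar; reference values `p β`, `p' β`; (RBL+SUP), (RBLΔ), (SF) as in
the module docstring.  Then `ε ≤ Q2 G r β L (a β) (θv) v` for all `β ≥ max β₅ 0` and all `L` with `Λ₅ ≤ aβ·L`.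
[folklore] -/
theorem Q2_floor_of_mirrorPackage_chiral (a : ℝ → ℝ) (ha₀ : ∀ β, 0 < a β)
    (v : 𝓢(EuclideanSpace ℝ (Fin 4), ℝ)) {ε : ℝ} (hε : 0 < ε) {β₅ Λ₅ : ℝ}
    (c : ℝ → (Fin 4 → ℤ)) (b : ℝ → ℕ) (p p' : ℝ → ℝ) (𝒢 : ℝ → LGConfig 4 G → ℝ)
    (hgeom : ∀ β, β₅ ≤ β → 1 ≤ c β 0 ∧ ∀ j : Fin 4, (|((c β j : ℤ) : ℝ)| + (b β : ℝ) + 3) * a β ≤ Λ₅)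
    (hsupp : ∀ β, β₅ ≤ β → ∀ x : Fin 4 → ℤ, v (a β • siteToE x) ≠ 0 →
      x ∈ cubeSites (c β) (b β) ∧ 2 ≤ depth (c β) (b β) x)
    (h𝒢 : ∀ β, β₅ ≤ β → Continuous (𝒢 β) ∧ (∃ M : ℝ, ∀ U, |𝒢 β U| ≤ M) ∧
      ∃ S : Finset (Literature.MathematicalPhysics.QuantumLattice.ZdEdge 4), IsCylinder (𝒢 β) S ∧
        ∀ e ∈ S, ∀ j, c β j - 1 ≤ e.1 j ∧ e.1 j ≤ c β j + b β + 1)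
    (hRBL : ∀ β, β₅ ≤ β → ∀ ζ,
      |kerE G r β (c β) (b β) ζ (fun V => ∑ y ∈ cubeSites (c β) (b β), v (a β • siteToE y) * dens G r y V) -
        p β + 𝒢 β ζ| ≤ Real.sqrt ε / 2)
    (hΔ : ∀ β, β₅ ≤ β → ∀ ζ,
      |kerE G r β (c β) (b β) ζ (fun V => ∑ x ∈ cubeSites (c β) (b β), v (a β • siteToE x) *
          ∑ q : {q : Fin 4 × Fin 4 // q.1 < q.2}, plane G r q.1 (if q.1.1 = 0 then x - Pi.single 0 1 else x) V) -
        kerE G r β (c β) (b β) ζ (fun V => ∑ y ∈ cubeSites (c β) (b β), v (a β • siteToE y) * dens G r y V) -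
        p' β| ≤ Real.sqrt ε / 2)
    (hSF : ∀ β, β₅ ≤ β → ∀ L : ℕ, Λ₅ ≤ a β * L →
      4 * ε ≤ torusE G r β L (fun V => 𝒢 β (cfgReflect V) * 𝒢 β V) -
        torusE G r β L (fun V => 𝒢 β (cfgReflect V)) * torusE G r β L (𝒢 β)) :
    ∀ β : ℝ, max β₅ 0 ≤ β → ∀ L : ℕ, Λ₅ ≤ a β * L → ε ≤ Q2 G r β L (a β) (thetaTest 4 v) v := by
  intro β hβ L hL
  have hβ₅ : β₅ ≤ β := le_trans (le_max_left _ _) hβ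
  have hβ0 : 0 ≤ β := le_trans (le_max_right _ _) hβ
  have hα : 0 < a β := ha₀ β
  obtain ⟨hc0, hsize⟩ := hgeom β hβ₅
  obtain ⟨h𝒢c, ⟨M𝒢, hM𝒢⟩, S𝒢, h𝒢S, hS𝒢⟩ := h𝒢 β hβ₅
  -- the cube and its collar fit in the torus box
  have hfit : ∀ j : Fin 4, |((c β j : ℤ) : ℝ)| + (b β : ℝ) + 3 ≤ (L : ℝ) := fun j =>
    le_of_mul_le_mul_right (by nlinarith [hsize j, hL]) hα
  have hfitZ : ∀ j : Fin 4, |c β j| + (b β : ℤ) + 3 ≤ (L : ℤ) := fun j => by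
    have h := hfit j
    rw [Int.cast_abs.symm] at h
    exact_mod_cast h
  have hc : ∀ j : Fin 4, -(L : ℤ) + 2 ≤ c β j ∧ c β j + (b β : ℤ) + 2 ≤ (L : ℤ) + 1 := fun j => by
    have h := hfitZ j
    have h1 := le_abs_self (c β j)
    have h2 := neg_abs_le (c β j)
    constructor <;> linarith
  have hcL : c β 0 + (b β : ℤ) + 3 ≤ L := by linarith [hfitZ 0, le_abs_self (c β 0)]
  exact Q2_ge_of_boundaryResponse_chiral G r hβ0 (c β) (b β) L hc0 hcL hc (a β) v (hsupp β hβ₅) h𝒢c hM𝒢 h𝒢S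
    hS𝒢 hε (hRBL β hβ₅) (hSF β hβ₅ L hL) (hΔ β hβ₅)

/-- **Clause (i) of `LowerBounds G r a` from the one-point Markov–mirror package.** [folklore] -/
theorem lowerBounds_fst_of_mirrorPackage_chiral (a : ℝ → ℝ) (ha₀ : ∀ β, 0 < a β)
    (v : 𝓢(EuclideanSpace ℝ (Fin 4), ℝ)) (hv : tsupport (v : EuclideanSpace ℝ (Fin 4) → ℝ) ⊆ {y | 0 < y 0})
    {ε : ℝ} (hε : 0 < ε) {β₅ Λ₅ : ℝ}
    (c : ℝ → (Fin 4 → ℤ)) (b : ℝ → ℕ) (p p' : ℝ → ℝ) (𝒢 : ℝ → LGConfig 4 G → ℝ)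
    (hgeom : ∀ β, β₅ ≤ β → 1 ≤ c β 0 ∧ ∀ j : Fin 4, (|((c β j : ℤ) : ℝ)| + (b β : ℝ) + 3) * a β ≤ Λ₅)
    (hsupp : ∀ β, β₅ ≤ β → ∀ x : Fin 4 → ℤ, v (a β • siteToE x) ≠ 0 →
      x ∈ cubeSites (c β) (b β) ∧ 2 ≤ depth (c β) (b β) x)
    (h𝒢 : ∀ β, β₅ ≤ β → Continuous (𝒢 β) ∧ (∃ M : ℝ, ∀ U, |𝒢 β U| ≤ M) ∧
      ∃ S : Finset (Literature.MathematicalPhysics.QuantumLattice.ZdEdge 4), IsCylinder (𝒢 β) S ∧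
        ∀ e ∈ S, ∀ j, c β j - 1 ≤ e.1 j ∧ e.1 j ≤ c β j + b β + 1)
    (hRBL : ∀ β, β₅ ≤ β → ∀ ζ,
      |kerE G r β (c β) (b β) ζ (fun V => ∑ y ∈ cubeSites (c β) (b β), v (a β • siteToE y) * dens G r y V) -
        p β + 𝒢 β ζ| ≤ Real.sqrt ε / 2)
    (hΔ : ∀ β, β₅ ≤ β → ∀ ζ,
      |kerE G r β (c β) (b β) ζ (fun V => ∑ x ∈ cubeSites (c β) (b β), v (a β • siteToE x) *
          ∑ q : {q : Fin 4 × Fin 4 // q.1 < q.2}, plane G r q.1 (if q.1.1 = 0 then x - Pi.single 0 1 else x) V) -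
        kerE G r β (c β) (b β) ζ (fun V => ∑ y ∈ cubeSites (c β) (b β), v (a β • siteToE y) * dens G r y V) -
        p' β| ≤ Real.sqrt ε / 2)
    (hSF : ∀ β, β₅ ≤ β → ∀ L : ℕ, Λ₅ ≤ a β * L →
      4 * ε ≤ torusE G r β L (fun V => 𝒢 β (cfgReflect V) * 𝒢 β V) -
        torusE G r β L (fun V => 𝒢 β (cfgReflect V)) * torusE G r β L (𝒢 β)) :
    ∃ (v : 𝓢(EuclideanSpace ℝ (Fin 4), ℝ)) (ε β₅ Λ₅ : ℝ),
      tsupport (v : EuclideanSpace ℝ (Fin 4) → ℝ) ⊆ {y : EuclideanSpace ℝ (Fin 4) | 0 < y 0} ∧ 0 < ε ∧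
      ∀ β : ℝ, β₅ ≤ β → ∀ L : ℕ, Λ₅ ≤ a β * L → ε ≤ Q2 G r β L (a β) (thetaTest 4 v) v :=
  ⟨v, ε, max β₅ 0, Λ₅, hv, hε,
    Q2_floor_of_mirrorPackage_chiral G r a ha₀ v hε c b p p' 𝒢 hgeom hsupp h𝒢 hRBL hΔ hSF⟩

/-- **The two-point conjunct of `UVSeamRec.stub_floorsEngine` (v4-F) from the one-point Markov–mirror package**:
the same floor with the compact support of the witness recorded (as the floors-engine stub of crux `UVSeamRec`,
stmt-QuantumFields-20043, asks at `(SU(2), rF)`; here for any `(G, r, a)`). [folklore] -/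
theorem floorsTwoPoint_of_mirrorPackage_chiral (a : ℝ → ℝ) (ha₀ : ∀ β, 0 < a β)
    (v : 𝓢(EuclideanSpace ℝ (Fin 4), ℝ)) (hvK : HasCompactSupport (v : EuclideanSpace ℝ (Fin 4) → ℝ))
    (hv : tsupport (v : EuclideanSpace ℝ (Fin 4) → ℝ) ⊆ {y | 0 < y 0})
    {ε : ℝ} (hε : 0 < ε) {β₅ Λ₅ : ℝ}
    (c : ℝ → (Fin 4 → ℤ)) (b : ℝ → ℕ) (p p' : ℝ → ℝ) (𝒢 : ℝ → LGConfig 4 G → ℝ)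
    (hgeom : ∀ β, β₅ ≤ β → 1 ≤ c β 0 ∧ ∀ j : Fin 4, (|((c β j : ℤ) : ℝ)| + (b β : ℝ) + 3) * a β ≤ Λ₅)
    (hsupp : ∀ β, β₅ ≤ β → ∀ x : Fin 4 → ℤ, v (a β • siteToE x) ≠ 0 →
      x ∈ cubeSites (c β) (b β) ∧ 2 ≤ depth (c β) (b β) x)
    (h𝒢 : ∀ β, β₅ ≤ β → Continuous (𝒢 β) ∧ (∃ M : ℝ, ∀ U, |𝒢 β U| ≤ M) ∧
      ∃ S : Finset (Literature.MathematicalPhysics.QuantumLattice.ZdEdge 4), IsCylinder (𝒢 β) S ∧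
        ∀ e ∈ S, ∀ j, c β j - 1 ≤ e.1 j ∧ e.1 j ≤ c β j + b β + 1)
    (hRBL : ∀ β, β₅ ≤ β → ∀ ζ,
      |kerE G r β (c β) (b β) ζ (fun V => ∑ y ∈ cubeSites (c β) (b β), v (a β • siteToE y) * dens G r y V) -
        p β + 𝒢 β ζ| ≤ Real.sqrt ε / 2)
    (hΔ : ∀ β, β₅ ≤ β → ∀ ζ,
      |kerE G r β (c β) (b β) ζ (fun V => ∑ x ∈ cubeSites (c β) (b β), v (a β • siteToE x) *
          ∑ q : {q : Fin 4 × Fin 4 // q.1 < q.2}, plane G r q.1 (if q.1.1 = 0 then x - Pi.single 0 1 else x) V) -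
        kerE G r β (c β) (b β) ζ (fun V => ∑ y ∈ cubeSites (c β) (b β), v (a β • siteToE y) * dens G r y V) -
        p' β| ≤ Real.sqrt ε / 2)
    (hSF : ∀ β, β₅ ≤ β → ∀ L : ℕ, Λ₅ ≤ a β * L →
      4 * ε ≤ torusE G r β L (fun V => 𝒢 β (cfgReflect V) * 𝒢 β V) -
        torusE G r β L (fun V => 𝒢 β (cfgReflect V)) * torusE G r β L (𝒢 β)) :
    ∃ (v : 𝓢(EuclideanSpace ℝ (Fin 4), ℝ)) (ε β₅ Λ₅ : ℝ),
      HasCompactSupport (v : EuclideanSpace ℝ (Fin 4) → ℝ) ∧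
      tsupport (v : EuclideanSpace ℝ (Fin 4) → ℝ) ⊆ {y : EuclideanSpace ℝ (Fin 4) | 0 < y 0} ∧ 0 < ε ∧
      ∀ β : ℝ, β₅ ≤ β → ∀ L : ℕ, Λ₅ ≤ a β * L → ε ≤ Q2 G r β L (a β) (thetaTest 4 v) v :=
  ⟨v, ε, max β₅ 0, Λ₅, hvK, hv, hε,
    Q2_floor_of_mirrorPackage_chiral G r a ha₀ v hε c b p p' 𝒢 hgeom hsupp h𝒢 hRBL hΔ hSF⟩

/-- **`NT` BY NAME from the one-point Markov–mirror line**: for every compact simple `G` (Borel σ-algebra), a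
representation `r`, a unit map `a` (`0 < a → 0`), the one-point Markov–mirror package for ONE positive-time test
function, and ANY supplier of the three-point clause (ii), give `Summit.QuantumFields.YangMills.Theses.BalabanLadder.NT`.
[folklore] -/
theorem nt_of_markovMirror_chiral
    (h : ∀ (G : Type) [Group G] [TopologicalSpace G] [IsTopologicalGroup G] [CompactSpace G],
      IsCompactSimpleLieGroup G → letI : MeasurableSpace G := borel G; haveI : BorelSpace G := ⟨rfl⟩;
      ∃ (r : LatticeRep G) (a : ℝ → ℝ), (∀ β, 0 < a β) ∧ Tendsto a atTop (𝓝 0) ∧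
        (∃ (v : 𝓢(EuclideanSpace ℝ (Fin 4), ℝ)) (ε β₅ Λ₅ : ℝ) (c : ℝ → (Fin 4 → ℤ)) (b : ℝ → ℕ)
          (p p' : ℝ → ℝ) (𝒢 : ℝ → LGConfig 4 G → ℝ),
          tsupport (v : EuclideanSpace ℝ (Fin 4) → ℝ) ⊆ {y | 0 < y 0} ∧ 0 < ε ∧
          (∀ β, β₅ ≤ β → 1 ≤ c β 0 ∧ ∀ j : Fin 4, (|((c β j : ℤ) : ℝ)| + (b β : ℝ) + 3) * a β ≤ Λ₅) ∧
          (∀ β, β₅ ≤ β → ∀ x : Fin 4 → ℤ, v (a β • siteToE x) ≠ 0 →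
            x ∈ cubeSites (c β) (b β) ∧ 2 ≤ depth (c β) (b β) x) ∧
          (∀ β, β₅ ≤ β → Continuous (𝒢 β) ∧ (∃ M : ℝ, ∀ U, |𝒢 β U| ≤ M) ∧
            ∃ S : Finset (Literature.MathematicalPhysics.QuantumLattice.ZdEdge 4), IsCylinder (𝒢 β) S ∧
              ∀ e ∈ S, ∀ j, c β j - 1 ≤ e.1 j ∧ e.1 j ≤ c β j + b β + 1) ∧
          (∀ β, β₅ ≤ β → ∀ ζ,
            |kerE G r β (c β) (b β) ζ (fun V => ∑ y ∈ cubeSites (c β) (b β), v (a β • siteToE y) * dens G r y V) -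
              p β + 𝒢 β ζ| ≤ Real.sqrt ε / 2) ∧
          (∀ β, β₅ ≤ β → ∀ ζ,
            |kerE G r β (c β) (b β) ζ (fun V => ∑ x ∈ cubeSites (c β) (b β), v (a β • siteToE x) *
                ∑ q : {q : Fin 4 × Fin 4 // q.1 < q.2},
                  plane G r q.1 (if q.1.1 = 0 then x - Pi.single 0 1 else x) V) -
              kerE G r β (c β) (b β) ζ (fun V => ∑ y ∈ cubeSites (c β) (b β), v (a β • siteToE y) * dens G r y V) -
              p' β| ≤ Real.sqrt ε / 2) ∧
          (∀ β, β₅ ≤ β → ∀ L : ℕ, Λ₅ ≤ a β * L →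
            4 * ε ≤ torusE G r β L (fun V => 𝒢 β (cfgReflect V) * 𝒢 β V) -
              torusE G r β L (fun V => 𝒢 β (cfgReflect V)) * torusE G r β L (𝒢 β))) ∧
        (∃ (f g h : 𝓢(EuclideanSpace ℝ (Fin 4), ℝ)) (ε β₅ Λ₅ : ℝ), Disjoint (tsupport f) (tsupport g) ∧
          Disjoint (tsupport g) (tsupport h) ∧ Disjoint (tsupport f) (tsupport h) ∧ 0 < ε ∧
          ∀ β : ℝ, β₅ ≤ β → ∀ L : ℕ, Λ₅ ≤ a β * L → ε ≤ |Q3 G r β L (a β) f g h|)) :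
    Summit.QuantumFields.YangMills.Theses.BalabanLadder.NT := by
  intro G _ _ _ _ hG
  letI : MeasurableSpace G := borel G
  haveI : BorelSpace G := ⟨rfl⟩
  obtain ⟨r, a, ha₀, ha, ⟨v, ε, β₅, Λ₅, c, b, p, p', 𝒢, hv, hε, hgeom, hsupp, h𝒢, hRBL, hΔ, hSF⟩, h3⟩ := h G hG
  exact ⟨r, a, ha₀, ha,
    lowerBounds_fst_of_mirrorPackage_chiral G r a ha₀ v hv hε c b p p' 𝒢 hgeom hsupp h𝒢 hRBL hΔ hSF, h3⟩

end Package

end Summit.QuantumFields.YangMills.Cruxes.NT.MarkovMirror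

end
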